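import Summits.CriticalPhenomena.PercolationContinuityZ3.Theorems.PercNearOneGluingNoHeavyLowerTailCousinCex
import HarnessLib

/-!
# `NoHeavyLowerTail` (crux stmt-CriticalPhenomena-4575): the TWO-ROW CERTIFICATE with a single comparison
# port — "(dd-x)" — is FALSE at level `j = 2`: a certified weighted counterexample on six vertices

Prover `prim-hp-3` (hull-port line, gen 2), 2026-08-19; memo `run/shared/lean/prim/prim-hp-3/HULLPORT-REF-gen2.md` §4a,
census `run/shared/lean/ttrl/tps/DDX.md` (ttrl2).  Setting (`μ_w = prodBernoulli w` on `Fin n`, relays `A`, level `j`,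
`π(v) = {z ∈ A : v ↔ z}`, `N_v = |π(v)|`, lightness `I_w(v) = μ_w(N_v ≤ j)`): a non-relay observer `u` whose positive
pairs go to relays only (its PORTS), a port `x` of `u`, two further relays `c ≠ d` and a relay `i`, none of them a
port; `K = w` with the pairs at `u` switched off (`fun e => if u ∈ e then 0 else w e`).  The two ROWS are

* row 0: `m₀ = I_w(i) − μ_w(1 ≤ N_u ≤ j)`, `g₀ = I_w(i) − I_w(x)`;
* row 1: `m₁ = μ_w(i ↮ {u,c,d}, N_i ≤ j) − μ_w(i ↮ {u,c,d}, 1 ≤ |π(u) ∪ π(c) ∪ π(d)| ≤ j)`,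
  `g₁ = I_{w[cd ↦ 1]}(i) − I_{w[cd ↦ 1]}(x)`.

(dd-x) (prim-hp-3, the proposed certificate for the two-port case of the two-pendant-star inequality TPS,
reduction `Hyperedge.setCS_pair_of_twoRowCertificate`) asserted: if `x` maximises `I_K` over the ports of `u` and
`I_K(c) ≤ I_K(x)`, `I_K(d) ≤ I_K(x)`, then ONE multiplier serves both rows: `∃ λ ≥ 0, λ g₀ ≤ m₀ ∧ λ g₁ ≤ m₁`.
It holds in 3.09 M dominated census cases (ttrl2) and at `j = 1` in all data, but **it is false at `j = 2`**
(`not_twoRowCertificate`): `n = 6`, `A = {0,…,4}`, `j = 2`, `u = 5` with ports `3` (coin `1`) and `x = 4` (coin `1/20`),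
`c = 1`, `d = 2`, `i = 0`, `K`-pairs `0–2: 1/5, 0–3: 19/20, 1–2: 1/4, 1–3: 1/4, 2–4: 9/10`.  Exactly (2⁷ configurations):
`I_K = (2443/4000, 939/1600, 2463/4000, 987/1600, 16/25)` on `0,…,4` (so `x = 4` is the best port and dominates `c, d`);
`m₀ = 2329/4000 − 18759/32000 = −127/32000`, `g₀ = 2329/4000 − 9731/16000 = −83/3200` (row 0 forces `λ ≥ 127/830 ≈ 0.153`),
`m₁ = 1/25 − 0`, `g₁ = 1163/2000 − 1523/16000 = 7781/16000` (row 1 forces `λ ≤ 640/7781 ≈ 0.082`): no multiplier exists.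
Mechanism (ttrl2's corner, coarsened by the seat to 7 pairs with weights in 1/20ths): `x` is barely a port and almost
`K`-tied with `d` through the strong pair `2–4`; gluing `c–d` makes `x` heavy (`g₁` large) while the separated margin `m₁`
stays small; `u` sits on the other port.  The two-sided inequality TPS itself is NOT refuted here (the instance has one star).

Contents: `Bool` tests on reach tables of `Fin 6` (relays `{0,…,4}`, level 2) and exact counts, the witness lists
(`wit q` with the pair `1–2` FIRST so that gluing is `q ↦ 1` via `CousinCex.update_wOfList_cons_one`; `witK` = the
pairs at `u` switched off), the arithmetic by kernel reduction (`decide +kernel`, standard axioms, no `native_decide`),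
the measure side via `WorstPairExchangeCex.real_eq_wcount`, and the deliverable.  No sorries; `def`s are checkers / data.
-/

namespace Summit.CriticalPhenomena.PercolationContinuityZ3.Theorems

open MeasureTheory
open Literature.Probability.LatticeModels Literature.Probability.Percolation
open Summit.CriticalPhenomena.PercolationContinuityZ3.Theorems.AdditiveGluing.Negative.Cert
open Summit.CriticalPhenomena.PercolationContinuityZ3.Theorems.WorstPairExchangeCex (real_eq_wcount)

namespace TwoRowCertCex

/-! ### Events as `Bool` tests on reach tables (`Fin 6`, relays `{0,…,4}`, level `2`, observer set `{5,1,2}`) -/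

/-- Number of relays `{0,…,4}` reachable from `v` on a reach table of `Fin 6`. -/
def nrel5 (tb : List ℕ) (v : Fin 6) : ℕ :=
  (({0, 1, 2, 3, 4} : Finset (Fin 6)).filter fun z : Fin 6 => (tb.getD v.val 0).testBit z.val = true).card

/-- Number of relays `{0,…,4}` reachable from some member of `{5,1,2}`. -/
def nrelY (tb : List ℕ) : ℕ :=
  (({0, 1, 2, 3, 4} : Finset (Fin 6)).filter fun z : Fin 6 =>
    ∃ y ∈ ({5, 1, 2} : Finset (Fin 6)), (tb.getD y.val 0).testBit z.val = true).card

/-- `N_v ≤ 2`. -/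
def lightB (tb : List ℕ) (v : Fin 6) : Bool := decide (nrel5 tb v ≤ 2)

/-- `1 ≤ N_v ≤ 2`. -/
def badB (tb : List ℕ) (v : Fin 6) : Bool := decide (1 ≤ nrel5 tb v ∧ nrel5 tb v ≤ 2)

/-- `v ↮ {5,1,2}` and `N_v ≤ 2`. -/
def sepLightB (tb : List ℕ) (v : Fin 6) : Bool :=
  decide ((∀ y ∈ ({5, 1, 2} : Finset (Fin 6)), (tb.getD v.val 0).testBit y.val = false) ∧ nrel5 tb v ≤ 2)

/-- `v ↮ {5,1,2}` and `1 ≤ |π(5) ∪ π(1) ∪ π(2)| ≤ 2`. -/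
def sepBadB (tb : List ℕ) (v : Fin 6) : Bool :=
  decide ((∀ y ∈ ({5, 1, 2} : Finset (Fin 6)), (tb.getD v.val 0).testBit y.val = false) ∧
    1 ≤ nrelY tb ∧ nrelY tb ≤ 2)

/-- Exact count of `{N_v ≤ 2}`. -/
def cntLight (l : List (Fin 6 × Fin 6 × ℚ)) (v : Fin 6) : ℚ :=
  ((wtabs 6 l).map fun t => if lightB t.1 v then t.2 else 0).sum

/-- Exact count of `{1 ≤ N_v ≤ 2}`. -/
def cntBad (l : List (Fin 6 × Fin 6 × ℚ)) (v : Fin 6) : ℚ :=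
  ((wtabs 6 l).map fun t => if badB t.1 v then t.2 else 0).sum

/-- Exact count of `{v ↮ {5,1,2}, N_v ≤ 2}`. -/
def cntSepLight (l : List (Fin 6 × Fin 6 × ℚ)) (v : Fin 6) : ℚ :=
  ((wtabs 6 l).map fun t => if sepLightB t.1 v then t.2 else 0).sum

/-- Exact count of `{v ↮ {5,1,2}, 1 ≤ |π(5) ∪ π(1) ∪ π(2)| ≤ 2}`. -/
def cntSepBad (l : List (Fin 6 × Fin 6 × ℚ)) (v : Fin 6) : ℚ :=
  ((wtabs 6 l).map fun t => if sepBadB t.1 v then t.2 else 0).sum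

/-! ### The witness -/

/-- The witness, `q` = weight of the pair `1–2` (listed first): `1–2 q · 0–2 1/5 · 0–3 19/20 · 1–3 1/4 · 2–4 9/10 ·
3–5 1 · 4–5 1/20` (`5` = the observer `u`, ports `3, 4`). -/
def wit (q : ℚ) : List (Fin 6 × Fin 6 × ℚ) :=
  [(1, 2, q), (0, 2, 1/5), (0, 3, 19/20), (1, 3, 1/4), (2, 4, 9/10), (3, 5, 1), (4, 5, 1/20)]

/-- The witness with the pairs at `u = 5` switched off (the graph `K`). -/
def witK : List (Fin 6 × Fin 6 × ℚ) :=
  [(1, 2, 1/4), (0, 2, 1/5), (0, 3, 19/20), (1, 3, 1/4), (2, 4, 9/10), (3, 5, 0), (4, 5, 0)]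

/-- The listed pairs of the witness are distinct. [this file] -/
theorem wit_nodup (q : ℚ) : (wPairs (wit q)).Nodup := by
  have h : wPairs (wit q) = wPairs (wit 0) := rfl
  rw [h]; decide

/-- The witness weights lie in `[0, 1]` when `q` does. [this file] -/
theorem wit_weights (q : ℚ) (hq : 0 ≤ q ∧ q ≤ 1) : ∀ e ∈ wit q, 0 ≤ e.2.2 ∧ e.2.2 ≤ 1 := by
  intro e he
  simp only [wit, List.mem_cons, List.not_mem_nil, or_false] at he
  rcases he with rfl | rfl | rfl | rfl | rfl | rfl | rfl
  · exact hq
  all_goals norm_num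

/-- The listed pairs of `witK` are distinct. [this file] -/
theorem witK_nodup : (wPairs witK).Nodup := by decide

/-- The `witK` weights lie in `[0, 1]`. [this file] -/
theorem witK_weights : ∀ e ∈ witK, 0 ≤ e.2.2 ∧ e.2.2 ≤ 1 := by
  intro e he
  simp only [witK, List.mem_cons, List.not_mem_nil, or_false] at he
  rcases he with rfl | rfl | rfl | rfl | rfl | rfl | rfl <;> norm_num

/-! ### The arithmetic (exact rational counts over `2⁷` configurations, kernel reduction) -/

/-- The seven counts of the unglued / glued witness: `I(0) = 2329/4000`, `I(4) = 9731/16000`, `μ(1 ≤ N_5 ≤ 2) = 18759/32000`,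
`μ(0 ↮ {5,1,2}, N_0 ≤ 2) = 1/25`, `μ(0 ↮ {5,1,2}, 1 ≤ |π(5)∪π(1)∪π(2)| ≤ 2) = 0`; after gluing `1–2`:
`I(0) = 1163/2000`, `I(4) = 1523/16000`. [this file] -/
theorem values_wit : cntLight (wit (1/4)) 0 = 2329/4000 ∧ cntLight (wit (1/4)) 4 = 9731/16000 ∧
    cntBad (wit (1/4)) 5 = 18759/32000 ∧ cntSepLight (wit (1/4)) 0 = 1/25 ∧ cntSepBad (wit (1/4)) 0 = 0 ∧
    cntLight (wit 1) 0 = 1163/2000 ∧ cntLight (wit 1) 4 = 1523/16000 := by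
  decide +kernel

/-- The `K`-lightnesses: `I_K(1) = 939/1600`, `I_K(2) = 2463/4000`, `I_K(3) = 987/1600` are all `≤ I_K(4) = 16/25`.
[this file] -/
theorem values_witK : cntLight witK 1 ≤ cntLight witK 4 ∧ cntLight witK 2 ≤ cntLight witK 4 ∧
    cntLight witK 3 ≤ cntLight witK 4 := by
  decide +kernel

/-! ### Weight bookkeeping -/

/-- Switching off the pairs at `u = 5` in the witness gives `witK`. [this file] -/
theorem K_eq : (fun e : Sym2 (Fin 6) => if (5 : Fin 6) ∈ e then (0 : unitInterval) else wOfList (wit (1/4)) e) =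
    wOfList witK := by
  funext e
  revert e
  refine Sym2.ind fun a b => ?_
  fin_cases a <;> fin_cases b <;>
    simp [wOfList, wit, witK, mkE]

/-- Pairs not listed in the witness have weight `0`. [this file] -/
theorem wit_off (e : Sym2 (Fin 6)) (he : e ∉ wE (wit (1/4))) : wOfList (wit (1/4)) e = 0 :=
  wOfList_eq_zero _ e he

/-- The port pair `4–5` has nonzero weight (`1/20`). [this file] -/
theorem wit_45_ne_zero : wOfList (wit (1/4)) s(5, 4) ≠ 0 := by
  have h' : wOfList (wit (1/4)) s((5 : Fin 6), 4) = Set.projIcc (0 : ℝ) 1 zero_le_one ((1/20 : ℚ) : ℝ) := by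
    simp [wit, wOfList, mkE]
  rw [h']
  intro h
  have h2 := congrArg Subtype.val h
  simp [Set.projIcc] at h2
  norm_num at h2

/-! ### Measure side -/

open scoped Classical

/-- Per-configuration agreement of the relay count. [this file] -/
theorem nrel5_reachTable (ω : List (Fin 6 × Fin 6)) (v : Fin 6) :
    nrel5 (reachTable 6 ω) v =
      (({0, 1, 2, 3, 4} : Finset (Fin 6)).filter fun z => (↑(Eset ω) : Set (Sym2 (Fin 6))) ∈ openConn v z).card := by
  unfold nrel5
  rw [Finset.filter_congr fun z _ => testBit_reachTable_iff_mem_openConn ω v z]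

/-- Per-configuration agreement of the joint relay count of `{5,1,2}`. [this file] -/
theorem nrelY_reachTable (ω : List (Fin 6 × Fin 6)) :
    nrelY (reachTable 6 ω) =
      (({0, 1, 2, 3, 4} : Finset (Fin 6)).filter fun z =>
        ∃ y ∈ ({5, 1, 2} : Finset (Fin 6)), (↑(Eset ω) : Set (Sym2 (Fin 6))) ∈ openConn y z).card := by
  unfold nrelY
  congr 1
  refine Finset.filter_congr fun z _ => ?_
  simp only [testBit_reachTable_iff_mem_openConn]

/-- `I(v) = cntLight`. [this file] -/
theorem real_light {l : List (Fin 6 × Fin 6 × ℚ)} (hnd : (wPairs l).Nodup)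
    (hq : ∀ e ∈ l, 0 ≤ e.2.2 ∧ e.2.2 ≤ 1) (v : Fin 6) :
    (prodBernoulli (wOfList l)).real
        {ω : BondConfig (Fin 6) |
          (({0, 1, 2, 3, 4} : Finset (Fin 6)).filter fun z => ω ∈ openConn v z).card ≤ 2} = (cntLight l v : ℝ) := by
  refine real_eq_wcount hnd hq (fun tb => lightB tb v) _ fun ω => ?_
  simp only [lightB, decide_eq_true_eq, Set.mem_setOf_eq, nrel5_reachTable]

/-- `μ(1 ≤ N_v ≤ 2) = cntBad`. [this file] -/
theorem real_bad {l : List (Fin 6 × Fin 6 × ℚ)} (hnd : (wPairs l).Nodup)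
    (hq : ∀ e ∈ l, 0 ≤ e.2.2 ∧ e.2.2 ≤ 1) (v : Fin 6) :
    (prodBernoulli (wOfList l)).real
        {ω : BondConfig (Fin 6) |
          1 ≤ (({0, 1, 2, 3, 4} : Finset (Fin 6)).filter fun z => ω ∈ openConn v z).card ∧
          (({0, 1, 2, 3, 4} : Finset (Fin 6)).filter fun z => ω ∈ openConn v z).card ≤ 2} = (cntBad l v : ℝ) := by
  refine real_eq_wcount hnd hq (fun tb => badB tb v) _ fun ω => ?_
  simp only [badB, decide_eq_true_eq, Set.mem_setOf_eq, nrel5_reachTable]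

/-- `μ(v ↮ {5,1,2}, N_v ≤ 2) = cntSepLight`. [this file] -/
theorem real_sepLight {l : List (Fin 6 × Fin 6 × ℚ)} (hnd : (wPairs l).Nodup)
    (hq : ∀ e ∈ l, 0 ≤ e.2.2 ∧ e.2.2 ≤ 1) (v : Fin 6) :
    (prodBernoulli (wOfList l)).real
        {ω : BondConfig (Fin 6) | (∀ y ∈ ({5, 1, 2} : Finset (Fin 6)), ω ∉ openConn v y) ∧
          (({0, 1, 2, 3, 4} : Finset (Fin 6)).filter fun z => ω ∈ openConn v z).card ≤ 2} =
      (cntSepLight l v : ℝ) := by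
  refine real_eq_wcount hnd hq (fun tb => sepLightB tb v) _ fun ω => ?_
  simp only [sepLightB, decide_eq_true_eq, Set.mem_setOf_eq, nrel5_reachTable, Bool.eq_false_iff, ne_eq,
    testBit_reachTable_iff_mem_openConn]

/-- `μ(v ↮ {5,1,2}, 1 ≤ |π(5)∪π(1)∪π(2)| ≤ 2) = cntSepBad`. [this file] -/
theorem real_sepBad {l : List (Fin 6 × Fin 6 × ℚ)} (hnd : (wPairs l).Nodup)
    (hq : ∀ e ∈ l, 0 ≤ e.2.2 ∧ e.2.2 ≤ 1) (v : Fin 6) :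
    (prodBernoulli (wOfList l)).real
        {ω : BondConfig (Fin 6) | (∀ y ∈ ({5, 1, 2} : Finset (Fin 6)), ω ∉ openConn v y) ∧
          1 ≤ (({0, 1, 2, 3, 4} : Finset (Fin 6)).filter fun z =>
            ∃ y ∈ ({5, 1, 2} : Finset (Fin 6)), ω ∈ openConn y z).card ∧
          (({0, 1, 2, 3, 4} : Finset (Fin 6)).filter fun z =>
            ∃ y ∈ ({5, 1, 2} : Finset (Fin 6)), ω ∈ openConn y z).card ≤ 2} =
      (cntSepBad l v : ℝ) := by
  refine real_eq_wcount hnd hq (fun tb => sepBadB tb v) _ fun ω => ?_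
  simp only [sepBadB, decide_eq_true_eq, Set.mem_setOf_eq, nrelY_reachTable, Bool.eq_false_iff, ne_eq,
    testBit_reachTable_iff_mem_openConn]

end TwoRowCertCex

open TwoRowCertCex
open scoped Classical

/-- **The two-row certificate (dd-x) is FALSE.**  It is NOT true that for all `n`, relays `A`, levels `j ≥ 1` with
`j + 3 ≤ |A|`, weights `w`, a non-relay `u` whose positive pairs go to relays only, a port `x ∈ A` of `u`
(`w s(u,x) ≠ 0`), relays `c ≠ d` and `i` that are not ports and pairwise distinct from `x` and each other, with
`K = (fun e => if u ∈ e then 0 else w e)`: if every port `p` of `u` has `I_K(p) ≤ I_K(x)` and `I_K(c) ≤ I_K(x)`,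
`I_K(d) ≤ I_K(x)`, then some `λ ≥ 0` satisfies both `λ·(I_w(i) − I_w(x)) ≤ I_w(i) − μ_w(1 ≤ N_u ≤ j)` and
`λ·(I_{w[cd↦1]}(i) − I_{w[cd↦1]}(x)) ≤ μ_w(i ↮ {u,c,d}, N_i ≤ j) − μ_w(i ↮ {u,c,d}, 1 ≤ |π(u)∪π(c)∪π(d)| ≤ j)`
(witness: `n = 6`, `A = {0,…,4}`, `j = 2`, `u = 5`, `x = 4`, `c = 1`, `d = 2`, `i = 0`, weights `wit (1/4)`). [this file] -/
theorem not_twoRowCertificate :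
    ¬ (∀ (n : ℕ) (A : Finset (Fin n)) (j : ℕ) (w : Sym2 (Fin n) → unitInterval) (u x c d i : Fin n),
      1 ≤ j → j + 3 ≤ A.card → u ∉ A → x ∈ A → c ∈ A → d ∈ A → i ∈ A →
      c ≠ d → x ≠ c → x ≠ d → i ≠ x → i ≠ c → i ≠ d →
      (∀ v : Fin n, v ∉ A → w s(u, v) = 0) →
      w s(u, x) ≠ 0 → w s(u, i) = 0 → w s(u, c) = 0 → w s(u, d) = 0 →
      (∀ p ∈ A, w s(u, p) ≠ 0 →
        (prodBernoulli (fun e => if u ∈ e then (0 : unitInterval) else w e)).real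
            {ω : BondConfig (Fin n) | (A.filter fun z => ω ∈ openConn p z).card ≤ j} ≤
          (prodBernoulli (fun e => if u ∈ e then (0 : unitInterval) else w e)).real
            {ω : BondConfig (Fin n) | (A.filter fun z => ω ∈ openConn x z).card ≤ j}) →
      (prodBernoulli (fun e => if u ∈ e then (0 : unitInterval) else w e)).real
          {ω : BondConfig (Fin n) | (A.filter fun z => ω ∈ openConn c z).card ≤ j} ≤
        (prodBernoulli (fun e => if u ∈ e then (0 : unitInterval) else w e)).real
          {ω : BondConfig (Fin n) | (A.filter fun z => ω ∈ openConn x z).card ≤ j} →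
      (prodBernoulli (fun e => if u ∈ e then (0 : unitInterval) else w e)).real
          {ω : BondConfig (Fin n) | (A.filter fun z => ω ∈ openConn d z).card ≤ j} ≤
        (prodBernoulli (fun e => if u ∈ e then (0 : unitInterval) else w e)).real
          {ω : BondConfig (Fin n) | (A.filter fun z => ω ∈ openConn x z).card ≤ j} →
      ∃ lam : ℝ, 0 ≤ lam ∧
        lam * ((prodBernoulli w).real {ω : BondConfig (Fin n) | (A.filter fun z => ω ∈ openConn i z).card ≤ j} -
            (prodBernoulli w).real {ω : BondConfig (Fin n) | (A.filter fun z => ω ∈ openConn x z).card ≤ j}) ≤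
          (prodBernoulli w).real {ω : BondConfig (Fin n) | (A.filter fun z => ω ∈ openConn i z).card ≤ j} -
            (prodBernoulli w).real {ω : BondConfig (Fin n) |
              1 ≤ (A.filter fun z => ω ∈ openConn u z).card ∧ (A.filter fun z => ω ∈ openConn u z).card ≤ j} ∧
        lam * ((prodBernoulli (Function.update w s(c, d) 1)).real
              {ω : BondConfig (Fin n) | (A.filter fun z => ω ∈ openConn i z).card ≤ j} -
            (prodBernoulli (Function.update w s(c, d) 1)).real
              {ω : BondConfig (Fin n) | (A.filter fun z => ω ∈ openConn x z).card ≤ j}) ≤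
          (prodBernoulli w).real {ω : BondConfig (Fin n) |
              (∀ y ∈ ({u, c, d} : Finset (Fin n)), ω ∉ openConn i y) ∧
              (A.filter fun z => ω ∈ openConn i z).card ≤ j} -
            (prodBernoulli w).real {ω : BondConfig (Fin n) |
              (∀ y ∈ ({u, c, d} : Finset (Fin n)), ω ∉ openConn i y) ∧
              1 ≤ (A.filter fun z => ∃ y ∈ ({u, c, d} : Finset (Fin n)), ω ∈ openConn y z).card ∧
              (A.filter fun z => ∃ y ∈ ({u, c, d} : Finset (Fin n)), ω ∈ openConn y z).card ≤ j}) := by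
  intro h
  have hq : (0 : ℚ) ≤ 1/4 ∧ (1/4 : ℚ) ≤ 1 := by norm_num
  have hq1 : (0 : ℚ) ≤ 1 ∧ (1 : ℚ) ≤ 1 := ⟨zero_le_one, le_rfl⟩
  obtain ⟨hLi, hLx, hBu, hSL, hSB, hLi', hLx'⟩ := values_wit
  obtain ⟨hK1, hK2, hK3⟩ := values_witK
  -- the hypotheses of the principle at the witness
  have hoff : ∀ v : Fin 6, v ∉ ({0, 1, 2, 3, 4} : Finset (Fin 6)) → wOfList (wit (1/4)) s(5, v) = 0 := by
    intro v hv
    have hv5 : v = 5 := by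
      fin_cases v <;> simp at hv ⊢
    subst hv5
    exact wit_off _ (by decide)
  have hKle : ∀ v : Fin 6, v = 1 ∨ v = 2 ∨ v = 3 →
      (prodBernoulli (fun e => if (5 : Fin 6) ∈ e then (0 : unitInterval) else wOfList (wit (1/4)) e)).real
          {ω : BondConfig (Fin 6) | (({0, 1, 2, 3, 4} : Finset (Fin 6)).filter fun z => ω ∈ openConn v z).card ≤ 2} ≤
        (prodBernoulli (fun e => if (5 : Fin 6) ∈ e then (0 : unitInterval) else wOfList (wit (1/4)) e)).real
          {ω : BondConfig (Fin 6) | (({0, 1, 2, 3, 4} : Finset (Fin 6)).filter fun z => ω ∈ openConn 4 z).card ≤ 2} := by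
    intro v hv
    rw [K_eq, real_light witK_nodup witK_weights, real_light witK_nodup witK_weights]
    rcases hv with rfl | rfl | rfl
    · exact_mod_cast hK1
    · exact_mod_cast hK2
    · exact_mod_cast hK3
  have hports : ∀ p ∈ ({0, 1, 2, 3, 4} : Finset (Fin 6)), wOfList (wit (1/4)) s(5, p) ≠ 0 →
      (prodBernoulli (fun e => if (5 : Fin 6) ∈ e then (0 : unitInterval) else wOfList (wit (1/4)) e)).real
          {ω : BondConfig (Fin 6) | (({0, 1, 2, 3, 4} : Finset (Fin 6)).filter fun z => ω ∈ openConn p z).card ≤ 2} ≤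
        (prodBernoulli (fun e => if (5 : Fin 6) ∈ e then (0 : unitInterval) else wOfList (wit (1/4)) e)).real
          {ω : BondConfig (Fin 6) | (({0, 1, 2, 3, 4} : Finset (Fin 6)).filter fun z => ω ∈ openConn 4 z).card ≤ 2} := by
    intro p hp hne
    simp only [Finset.mem_insert, Finset.mem_singleton] at hp
    rcases hp with rfl | rfl | rfl | rfl | rfl
    · exact absurd (wit_off _ (by decide)) hne
    · exact absurd (wit_off _ (by decide)) hne
    · exact absurd (wit_off _ (by decide)) hne
    · exact hKle 3 (Or.inr (Or.inr rfl))
    · exact le_rfl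
  have hc := h 6 {0, 1, 2, 3, 4} 2 (wOfList (wit (1/4))) 5 4 1 2 0 (by norm_num) (by decide) (by decide)
    (by decide) (by decide) (by decide) (by decide) (by decide) (by decide) (by decide) (by decide) (by decide)
    (by decide) hoff wit_45_ne_zero (wit_off _ (by decide)) (wit_off _ (by decide)) (wit_off _ (by decide))
    hports (hKle 1 (Or.inl rfl)) (hKle 2 (Or.inr (Or.inl rfl)))
  obtain ⟨lam, hlam, h0, h1⟩ := hc
  -- gluing `1–2` is `wit 1`
  have hglu : Function.update (wOfList (wit (1/4))) s((1 : Fin 6), 2) 1 = wOfList (wit 1) :=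
    CousinCex.update_wOfList_cons_one (1 : Fin 6) 2 (1/4) _
  rw [real_light (wit_nodup _) (wit_weights _ hq), real_light (wit_nodup _) (wit_weights _ hq),
    TwoRowCertCex.real_bad (wit_nodup _) (wit_weights _ hq), hLi, hLx, hBu] at h0
  rw [hglu, real_light (wit_nodup _) (wit_weights _ hq1), real_light (wit_nodup _) (wit_weights _ hq1),
    real_sepLight (wit_nodup _) (wit_weights _ hq), real_sepBad (wit_nodup _) (wit_weights _ hq),
    hLi', hLx', hSL, hSB] at h1
  push_cast at h0 h1
  nlinarith
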